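import Literature.AlgebraicGeometry.AbelianSchemes.AbelianSchemePolarizationLinearityTransport
import Literature.AlgebraicGeometry.AbelianSchemes.SerreTwistPolarization
import HarnessLib

/-!
# The Serre-twisted polarization is `𝒪`-compatible (Kottwitz–RSZ condition `ι(σ a) ≫ λ = λ ≫ ι(a)^∨`) when `λ` is
# ([Kottwitz1992] §5; [RapoportSmithlingZhang2020Diagonal] §3.2, (4.23); [MumfordAV1970] §15 Thm. 1)

Topic `Literature/AlgebraicGeometry/AbelianSchemes`, namespaces `Literature.AlgebraicGeometry.AbelianSchemes.AbelianSchemeOver.RingAction` (§1) and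
`…AbelianSchemeOver` (§2).  THEOREMS ONLY (no definition, no named fact, no `instance`, no notation, no `sorry`); base `S` reduced and locally
Noetherian (the dual action ★ `RingAction.dual` lives there), unit hypotheses on the dual pairs.  Cell `hodgecm-mathlib`, F0/P6 «MOD», organ (O-γ)
«SERRE TWIST OF A PEL FAMILY», part (γ7) «𝒪-COMPATIBILITY OF THE TWISTED POLARIZATION» (lead hand A-p06 (g30); the moduli datum carries the
compatibility `λ ∘ ι(a) = ι(ā)^∨ ∘ λ` as a Prop of layer (ii-6)); sequel of ★ `AbelianSchemePolarizationLinearityTransport` (transport along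
equivariant ISOMORPHISMS) and ★ `SerreTwistPolarization` (p846320).  `--supports stmt-HodgeConjecture-24832`, count-neutral: HC_CM is proved only modulo the
2 remaining named inputs (hLiu418, h413) until rung 0 closes; this file discharges none of them.

## Mathematics

(§1, generic) For an `𝒪`-EQUIVARIANT HOMOMORPHISM `u : C → B` (`ι_C(a) ≫ u = u ≫ ι_B(a)`) — not necessarily an isomorphism — and `λ_B : B → B̂` with
`ι_B(σ a) ≫ λ_B = λ_B ≫ ι_B^∨(a)` for all `a`, the transported `u^*λ_B := u ≫ λ_B ≫ u^∨ : C → Ĉ` satisfies `ι_C(σ a) ≫ u^*λ_B = u^*λ_B ≫ ι_C^∨(a)`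
(`u^∨` is equivariant for the dual actions, ★ `RingAction.dual_i_comp_dualIsogenyOver`); and the condition DESCENDS along `[k]` (`k ≠ 0`): if `λ ≫ [k]`
is compatible then so is `λ` (`[k]` commutes with homomorphisms and is right-cancellable, ★ `cancel_right_of_comp_eq_pow_id`).
(§2, the twist) With `u := ψ′ = serreTranslateInv act E′ hE′ Q : A ⊗_𝒪 𝔟 → A` (equivariant, ★ `i_comp_serreTranslateInv`): the pull-back normalisation
`λ^{pull}` (★ `serreTwistLamPull`) of an `𝒪`-compatible polarization `λ` is `𝒪`-compatible for the Serre action `ι_𝔟` (★ `serreAction`), and so is every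
cover-exact `λ_𝔟` (`λ^{pull} = λ_𝔟 ≫ [k]`) — hence every `ψ_P`-exact one (★ `serreTwistLamPull_eq_of_isExactTwistPol`) — of the Serre-twisted tuple
`(A ⊗ 𝔞, ι, λ_𝔞, η)` of [RapoportSmithlingZhang2020Diagonal] §3.2, (4.23).

* §1 `comp_transport_hom_eq_of_compatible`, `compatible_of_comp_mulN_compatible`;
* §2 `serreAction_i_comp_serreTwistLamPull`, `serreAction_i_comp_of_serreTwistLamPull_eq_comp_mulN`, `serreAction_i_comp_of_isExactTwistPol`.

## References
* [Kottwitz1992] R. Kottwitz, *Points on some Shimura varieties over finite fields*, JAMS 5 (1992), §5 (p. 390).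
* [RapoportSmithlingZhang2020Diagonal] M. Rapoport, B. Smithling, W. Zhang, *Arithmetic diagonal cycles on unitary Shimura varieties*, Compositio Math. 156
  (2020), §3.2, (4.23).
* [MumfordAV1970] D. Mumford, *Abelian Varieties* (1970), §15 Thm. 1 (p. 143), §23 Thm. 2 (p. 231).
-/

noncomputable section

universe u

open CategoryTheory CategoryTheory.Limits AlgebraicGeometry MonoidalCategory CartesianMonoidalCategory
open scoped MonObj

namespace Literature.AlgebraicGeometry.AbelianSchemes

namespace AbelianSchemeOver

set_option backward.isDefEq.respectTransparency false

/-! ### §1 Transport along equivariant homomorphisms; descent along `[k]` -/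

namespace RingAction

variable {S : Scheme.{u}} [IsReduced S] [IsLocallyNoetherian S] {B C : AbelianSchemeOver S} {O : Type*} [CommRing O]
  (actB : B.RingAction O) (actC : C.RingAction O) (DB : B.DualPair) (DC : C.DualPair)
  (hDB : Nonempty ((Scheme.Modules.pullback (DualPair.unitHatSlice DB)).obj DB.P ≅ SheafOfModules.unit _))
  (hDC : Nonempty ((Scheme.Modules.pullback (DualPair.unitHatSlice DC)).obj DC.P ≅ SheafOfModules.unit _))
  (σ : O → O)

/-- **Transport of the action∕polarisation compatibility along an equivariant HOMOMORPHISM** `u : C → B` (★ `comp_transport_eq_of_compatible` is the case of an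
isomorphism): `ι_B(σ a) ≫ λ_B = λ_B ≫ ι_B^∨(a)` for all `a` ⟹ `ι_C(σ a) ≫ (u ≫ λ_B ≫ u^∨) = (u ≫ λ_B ≫ u^∨) ≫ ι_C^∨(a)`.
[cite: Kottwitz1992, §5 (p. 390)] [cite: RapoportSmithlingZhang2020Diagonal, §3.2] [cite: MumfordAV1970, §15 Thm. 1 (p. 143)] -/
theorem comp_transport_hom_eq_of_compatible (u : C.X ⟶ B.X) [IsMonHom u] (lamB : B.X ⟶ DB.hat.X)
    (hu : ∀ a, actC.i a ≫ u = u ≫ actB.i a) (hlam : ∀ a, actB.i (σ a) ≫ lamB = lamB ≫ (actB.dual DB hDB).i a) (a : O) :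
    actC.i (σ a) ≫ (u ≫ lamB ≫ DualPair.dualIsogenyOver u DC DB) =
      (u ≫ lamB ≫ DualPair.dualIsogenyOver u DC DB) ≫ (actC.dual DC hDC).i a := by
  have h1 := dual_i_comp_dualIsogenyOver u DC DB actC actB hDC hDB hu a
  calc actC.i (σ a) ≫ (u ≫ lamB ≫ DualPair.dualIsogenyOver u DC DB)
      = (actC.i (σ a) ≫ u) ≫ lamB ≫ DualPair.dualIsogenyOver u DC DB := by simp only [Category.assoc]
    _ = u ≫ (actB.i (σ a) ≫ lamB) ≫ DualPair.dualIsogenyOver u DC DB := by rw [hu (σ a)]; simp only [Category.assoc]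
    _ = u ≫ lamB ≫ ((actB.dual DB hDB).i a ≫ DualPair.dualIsogenyOver u DC DB) := by rw [hlam a]; simp only [Category.assoc]
    _ = (u ≫ lamB ≫ DualPair.dualIsogenyOver u DC DB) ≫ (actC.dual DC hDC).i a := by rw [h1]; simp only [Category.assoc]

/-- **The compatibility descends along `[k]`** (`k ≠ 0`): if `λ ≫ [k]_{B̂}` satisfies `ι(σ a) ≫ (λ ≫ [k]) = (λ ≫ [k]) ≫ ι^∨(a)` for all `a` and `λ` is a
homomorphism, then `ι(σ a) ≫ λ = λ ≫ ι^∨(a)` (`[k]` commutes with the homomorphism `ι^∨(a)` and is right-cancellable against homomorphisms out of `B`).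
[cite: MumfordAV1970, §7 Thm. 4 (p. 72) and §15 Thm. 1 (p. 143)] [cite: RapoportSmithlingZhang2020Diagonal, §3.2] -/
theorem compatible_of_comp_mulN_compatible {k : ℕ} (hk : k ≠ 0) (lam : B.X ⟶ DB.hat.X) [IsMonHom lam]
    (h : ∀ a, actB.i (σ a) ≫ (lam ≫ DB.hat.mulN k) = (lam ≫ DB.hat.mulN k) ≫ (actB.dual DB hDB).i a) (a : O) :
    actB.i (σ a) ≫ lam = lam ≫ (actB.dual DB hDB).i a := by
  haveI := actB.isMonHom (σ a)
  haveI := (actB.dual DB hDB).isMonHom a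
  refine cancel_right_of_comp_eq_pow_id B (DB.hat.mulN k) (𝟙 DB.hat.X) hk (by rw [Category.comp_id, mulN_def]) _ _ ?_
  -- `[k]` commutes past `ι^∨(a)`
  have hk' : DB.hat.mulN k ≫ (actB.dual DB hDB).i a = (actB.dual DB hDB).i a ≫ DB.hat.mulN k := by
    rw [mulN_def, MonObj.pow_comp, Category.id_comp, MonObj.comp_pow, Category.comp_id]
  have ha := h a
  rw [← Category.assoc, Category.assoc lam, hk', ← Category.assoc] at ha
  exact ha

end RingAction

/-! ### §2 The Serre twist -/

section Serre

variable {S : Scheme.{u}} [IsReduced S] [IsLocallyNoetherian S] {A : AbelianSchemeOver S} {O : Type*} [CommRing O] (act : A.RingAction O)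
  [IsCommMonObj A.X] {m : ℕ} (E' : Matrix (Fin m) (Fin m) O) (hE' : E' * E' = E') (P : Matrix (Fin m) (Fin 1) O) (Q : Matrix (Fin 1) (Fin m) O)
  {N : ℕ} (D : A.DualPair) (Db : (serreTensor act E' hE').DualPair)
  (hD : Nonempty ((Scheme.Modules.pullback (DualPair.unitHatSlice D)).obj D.P ≅ SheafOfModules.unit _))
  (hDb : Nonempty ((Scheme.Modules.pullback (DualPair.unitHatSlice Db)).obj Db.P ≅ SheafOfModules.unit _))
  (pol : A.Polarization D) (σ : O → O)

/-- **`λ^{pull}` IS `𝒪`-COMPATIBLE for the Serre action `ι_𝔟`** when `λ` is `𝒪`-compatible for `ι` (`ψ′` is equivariant, ★ `i_comp_serreTranslateInv`):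
`ι_𝔟(σ a) ≫ λ^{pull} = λ^{pull} ≫ ι_𝔟^∨(a)`. [cite: RapoportSmithlingZhang2020Diagonal, §3.2 and (4.23)] [cite: Kottwitz1992, §5 (p. 390)] -/
theorem serreAction_i_comp_serreTwistLamPull (hQ : Q * E' = Q) (hlam : ∀ a, act.i (σ a) ≫ pol.lam = pol.lam ≫ (act.dual D hD).i a) (a : O) :
    (serreAction act E' hE').i (σ a) ≫ serreTwistLamPull act E' hE' Q D Db pol =
      serreTwistLamPull act E' hE' Q D Db pol ≫ ((serreAction act E' hE').dual Db hDb).i a := by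
  haveI := isMonHom_serreTranslateInv act E' hE' Q
  rw [serreTwistLamPull_def]
  exact RingAction.comp_transport_hom_eq_of_compatible act (serreAction act E' hE') D Db hD hDb σ (serreTranslateInv act E' hE' Q) pol.lam
    (fun b => i_comp_serreTranslateInv act E' hE' Q hQ b) hlam a

/-- **A COVER-EXACT twisted polarization is `𝒪`-compatible**: if `λ^{pull} = λ_𝔟 ≫ [k]` (`k ≠ 0`, `λ_𝔟` a homomorphism) and `λ` is `𝒪`-compatible, then
`ι_𝔟(σ a) ≫ λ_𝔟 = λ_𝔟 ≫ ι_𝔟^∨(a)`. [cite: RapoportSmithlingZhang2020Diagonal, §3.2 and (4.23)] [cite: Kottwitz1992, §5 (p. 390)] -/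
theorem serreAction_i_comp_of_serreTwistLamPull_eq_comp_mulN (hQ : Q * E' = Q)
    (hlam : ∀ a, act.i (σ a) ≫ pol.lam = pol.lam ≫ (act.dual D hD).i a) {k : ℕ} (hk : k ≠ 0)
    {lam' : (serreTensor act E' hE').X ⟶ Db.hat.X} [IsMonHom lam'] (h : serreTwistLamPull act E' hE' Q D Db pol = lam' ≫ Db.hat.mulN k) (a : O) :
    (serreAction act E' hE').i (σ a) ≫ lam' = lam' ≫ ((serreAction act E' hE').dual Db hDb).i a := by
  refine RingAction.compatible_of_comp_mulN_compatible (serreAction act E' hE') Db hDb σ hk lam' (fun b => ?_) a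
  rw [← h]
  exact serreAction_i_comp_serreTwistLamPull act E' hE' Q D Db hD hDb pol σ hQ hlam b

/-- **A `ψ_P`-EXACT twisted polarization is `𝒪`-compatible** (★ `IsExactTwistPol … c λ′` with `c ∣ N²`): via ★ `serreTwistLamPull_eq_of_isExactTwistPol`
(`λ^{pull} = λ′ ≫ [N²∕c]`) and §2's cover-exact case. [cite: RapoportSmithlingZhang2020Diagonal, §3.2 and (4.23)] [cite: Kottwitz1992, §5 (p. 390)] -/
theorem serreAction_i_comp_of_isExactTwistPol (hN : N ≠ 0) (hP : E' * P = P) (hQ : Q * E' = Q)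
    (hQP : Q * P = Matrix.scalar (Fin 1) (N : O)) (hPQ : P * Q = Matrix.scalar (Fin m) (N : O) * E')
    (hlam : ∀ a, act.i (σ a) ≫ pol.lam = pol.lam ≫ (act.dual D hD).i a) {c k : ℕ} (hck : c * k = N ^ 2)
    {lam' : (serreTensor act E' hE').X ⟶ Db.hat.X} [IsMonHom lam'] (h : IsExactTwistPol act E' hE' P D Db pol c lam') (a : O) :
    (serreAction act E' hE').i (σ a) ≫ lam' = lam' ≫ ((serreAction act E' hE').dual Db hDb).i a := by
  have hk : k ≠ 0 := by
    rintro rfl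
    rw [mul_zero] at hck
    exact pow_ne_zero 2 hN hck.symm
  exact serreAction_i_comp_of_serreTwistLamPull_eq_comp_mulN act E' hE' Q D Db hD hDb pol σ hQ hlam hk
    (serreTwistLamPull_eq_of_isExactTwistPol act E' hE' P Q D Db hD hDb pol hN hP hQ hQP hPQ hck h) a

end Serre

end AbelianSchemeOver

end Literature.AlgebraicGeometry.AbelianSchemes

end
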